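import Mathlib.MeasureTheory.Measure.Count
import Mathlib.Topology.Algebra.Group.ClosedSubgroup
import Mathlib.Topology.Algebra.Group.Quotient
import Mathlib.Tactic.Group
import HarnessLib

/-!
# The conjugation family `Φ(xT, t) = x t x⁻¹` of a closed abelian subgroup: equivariance, local injectivity on the
# `T`-regular set, and the fibre count `|N_G(T) ∕ T|`
(the group-theoretic half of the Weyl integration formula; Harish-Chandra (1970), Lemma 42)

Topic `MeasureTheory/Group`; namespace `Literature.MeasureTheory.Group`.  Theorems only (no definition, no named
fact, no instance, no `sorry`); Mathlib only.

SETTING.  `G` a topological group, `T ≤ G` a subgroup (closed ∕ abelian where said), `Φ : G ⧸ T × T → G` any map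
with `Φ(xT, t) = x t x⁻¹` (the CONJUGATION FAMILY, a parameter pinned by this equation), `R ⊆ G` a set of «regular»
elements: conjugation invariant, and such that every `t ∈ T ∩ R` has centraliser EXACTLY `T`; `N_G(T) ∕ T` finite
(`(T.subgroupOf (normalizer T)).index ≠ 0`).  `D = {(xT, t) | t ∈ R}` is the `T`-regular part of `G ⧸ T × T`.

THE RESULTS (all PROVED).
* `continuous_conjFamily_and_smul`, `conjFamily_smul` — `Φ` is continuous and `G`-equivariant: `Φ(c • q, t) = c Φ(q, t) c⁻¹`.
* `mem_normalizer_of_conj_eq` — `n t n⁻¹ = t'` with `Z(t) = Z(t') = T` forces `n ∈ N_G(T)`.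
* `exists_isOpen_injOn_conjFamily` — **`Φ` is LOCALLY INJECTIVE on `D`** for `T` closed abelian with finite Weyl
  group: `T` is closed of finite index in `N_G(T)`, hence OPEN there (Mathlib
  `Subgroup.isOpen_of_isClosed_of_finiteIndex`), so two nearby points of `D` with the same image differ by an
  element of `N_G(T)` close to `1`, i.e. by an element of `T` — no differential calculus.
* `count_fibre_conjFamily_eq` — **every fibre of `Φ|_D` has exactly `|N_G(T) ∕ T|` points**: the fibre through
  `(x₀T, t₀)` is `{(x₀ n⁻¹ T, n t₀ n⁻¹)} ≃ N_G(T) ∕ T` (as `Measure.count`, the currency of ★ `FibreCountPullback`).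

WHY (the use).  These are the two non-analytic inputs of the Jacobian-free Weyl integration formula on the
`T`-regular set (`ConjugationWeylVanishing`: fibre-count pull-back of Haar measure, Weil's relative uniqueness); the
only analytic input left to a consumer is the OPENNESS of `Φ` (submersivity of conjugation at regular elements).
[cite: HarishChandra1970, Lemma 42] (the map `(x, t) ↦ x t x⁻¹` on `G∕A × A'` and its fibres, p-adic case).

## References
* [HarishChandra1970] Harish-Chandra, *Harmonic analysis on reductive p-adic groups*, LNM 162 (1970), Lemma 42.
* [Bourbaki] N. Bourbaki, *Topologie Générale* III §2 (open subgroups; quotients) — background only.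
-/

set_option autoImplicit false

noncomputable section

open MeasureTheory Measure Set Filter Topology Function
open scoped ENNReal NNReal Pointwise

namespace Literature.MeasureTheory.Group

section ConjFamily

variable {G : Type*} [Group G] [TopologicalSpace G] [IsTopologicalGroup G]
  (T : Subgroup G) (Φ : (G ⧸ T) × T → G) (hΦ : ∀ (x : G) (t : T), Φ (QuotientGroup.mk x, t) = x * t * x⁻¹)

include hΦ

omit [TopologicalSpace G] [IsTopologicalGroup G] in
/-- `G`-equivariance of the conjugation family: `Φ(c • q, t) = c Φ(q, t) c⁻¹`. [cite: HarishChandra1970, Lemma 42] -/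
theorem conjFamily_smul (c : G) (q : G ⧸ T) (t : T) : Φ (c • q, t) = c * Φ (q, t) * c⁻¹ := by
  induction q using QuotientGroup.induction_on with
  | H x =>
    rw [MulAction.Quotient.smul_mk, smul_eq_mul, hΦ, hΦ]
    simp only [mul_assoc, mul_inv_rev]

/-- The conjugation family `Φ(xT, t) = x t x⁻¹` is **continuous** (it lifts to the continuous `(x, t) ↦ x t x⁻¹`
along the open quotient map `G × T → G ⧸ T × T`) and `G`-**equivariant** (stated together: the pair is what the
measure-theoretic half consumes). [cite: HarishChandra1970, Lemma 42] -/
theorem continuous_conjFamily_and_smul :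
    Continuous Φ ∧ ∀ (c : G) (q : G ⧸ T) (t : T), Φ (c • q, t) = c * Φ (q, t) * c⁻¹ := by
  refine ⟨?_, conjFamily_smul T Φ hΦ⟩
  have hq : IsOpenQuotientMap (Prod.map (QuotientGroup.mk : G → G ⧸ T) (id : T → T)) :=
    ⟨QuotientGroup.mk_surjective.prodMap surjective_id,
      (QuotientGroup.continuous_mk.prodMap continuous_id), QuotientGroup.isOpenMap_coe.prodMap IsOpenMap.id⟩
  rw [← hq.continuous_comp_iff]
  have : Φ ∘ Prod.map (QuotientGroup.mk : G → G ⧸ T) (id : T → T) = fun p : G × T => p.1 * p.2 * p.1⁻¹ := by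
    funext p
    obtain ⟨x, t⟩ := p
    exact hΦ x t
  rw [this]
  fun_prop

omit [TopologicalSpace G] [IsTopologicalGroup G] hΦ in
/-- **Conjugating one `T`-regular element to another normalises `T`**: if `t, t' ∈ T` both have centraliser
exactly `T` and `n t n⁻¹ = t'`, then `n ∈ N_G(T)` (`h ∈ Z(t) ⟺ n h n⁻¹ ∈ Z(n t n⁻¹)`). [cite: HarishChandra1970, Lemma 42] -/
theorem mem_normalizer_of_conj_eq {t t' n : G} (ht : Subgroup.centralizer {t} = T)
    (ht' : Subgroup.centralizer {t'} = T) (h : n * t * n⁻¹ = t') : n ∈ Subgroup.normalizer (T : Set G) := by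
  rw [Subgroup.mem_normalizer_iff]
  intro g
  constructor
  · intro hg
    rw [← ht, Subgroup.mem_centralizer_singleton_iff] at hg
    rw [← ht', Subgroup.mem_centralizer_singleton_iff, ← h]
    calc n * g * n⁻¹ * (n * t * n⁻¹) = n * (g * t) * n⁻¹ := by group
      _ = n * (t * g) * n⁻¹ := by rw [hg]
      _ = n * t * n⁻¹ * (n * g * n⁻¹) := by group
  · intro hg
    rw [← ht', Subgroup.mem_centralizer_singleton_iff, ← h] at hg
    rw [← ht, Subgroup.mem_centralizer_singleton_iff]
    have h1 : n * (g * t) * n⁻¹ = n * (t * g) * n⁻¹ := by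
      calc n * (g * t) * n⁻¹ = n * g * n⁻¹ * (n * t * n⁻¹) := by group
        _ = n * t * n⁻¹ * (n * g * n⁻¹) := hg
        _ = n * (t * g) * n⁻¹ := by group
    have h2 := congrArg (fun y => n⁻¹ * y * n) h1
    simpa only [← mul_assoc, inv_mul_cancel, one_mul, mul_assoc, mul_inv_cancel, mul_one,
      inv_mul_cancel_left, mul_inv_cancel_right] using h2

end ConjFamily

section OneTorus

variable {G : Type*} [Group G] [TopologicalSpace G] [IsTopologicalGroup G]
  (T : Subgroup G) (hT : IsClosed (T : Set G)) (hTc : ∀ a ∈ T, ∀ b ∈ T, a * b = b * a)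
  (Φ : (G ⧸ T) × T → G) (hΦ : ∀ (x : G) (t : T), Φ (QuotientGroup.mk x, t) = x * t * x⁻¹)
  (R : Set G) (hRT : ∀ t : T, (t : G) ∈ R → Subgroup.centralizer {(t : G)} = T)
  (hRc : ∀ g x : G, x ∈ R → g * x * g⁻¹ ∈ R)
  (hW : (T.subgroupOf (Subgroup.normalizer (T : Set G))).index ≠ 0)

include hT hTc hΦ hRT hW in
/-- **Local injectivity of the conjugation family on the `T`-regular set.**  `T` is closed of finite index in
`N_G(T)`, hence open there: some neighbourhood `W` of `1` meets `N_G(T)` inside `T`.  If `x, x' ∈ x₀ V` with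
`V⁻¹ V ⊆ W` and `x t x⁻¹ = x' t' x'⁻¹` (`t, t' ∈ T ∩ R`), then `n = x'⁻¹ x ∈ N_G(T) ∩ W ⊆ T`, so `xT = x'T` and
`t' = n t n⁻¹ = t`. [cite: HarishChandra1970, Lemma 42] -/
theorem exists_isOpen_injOn_conjFamily (p : (G ⧸ T) × T) :
    ∃ U : Set ((G ⧸ T) × T), IsOpen U ∧ p ∈ U ∧
      InjOn Φ (U ∩ {p : (G ⧸ T) × T | ((p.2 : T) : G) ∈ R}) := by
  classical
  -- `T` is open in its normaliser
  set N : Subgroup G := Subgroup.normalizer (T : Set G) with hN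
  haveI : (T.subgroupOf N).FiniteIndex := ⟨hW⟩
  have hTN_closed : IsClosed ((T.subgroupOf N : Subgroup N) : Set N) := by
    change IsClosed ((Subgroup.subtype N) ⁻¹' (T : Set G))
    exact hT.preimage continuous_subtype_val
  have hTN_open : IsOpen ((T.subgroupOf N : Subgroup N) : Set N) :=
    Subgroup.isOpen_of_isClosed_of_finiteIndex _ hTN_closed
  obtain ⟨W, hWo, hWT⟩ : ∃ W : Set G, IsOpen W ∧ (Subtype.val : N → G) ⁻¹' W = (T.subgroupOf N : Set N) :=
    isOpen_induced_iff.1 hTN_open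
  have h1W : (1 : G) ∈ W := by
    have : (1 : N) ∈ (Subtype.val : N → G) ⁻¹' W := by
      rw [hWT]; exact Subgroup.one_mem _
    exact this
  have hWN : ∀ n : G, n ∈ N → n ∈ W → n ∈ T := by
    intro n hn hnW
    have : (⟨n, hn⟩ : N) ∈ (Subtype.val : N → G) ⁻¹' W := hnW
    rw [hWT] at this
    exact Subgroup.mem_subgroupOf.1 this
  -- a neighbourhood `V` of `1` with `V⁻¹ V ⊆ W`
  have hcont : Continuous fun q : G × G => q.1⁻¹ * q.2 := by fun_prop
  have hpre : (fun q : G × G => q.1⁻¹ * q.2) ⁻¹' W ∈ 𝓝 ((1 : G), (1 : G)) :=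
    hcont.continuousAt.preimage_mem_nhds (by simpa using hWo.mem_nhds h1W)
  obtain ⟨V₁, hV₁, V₂, hV₂, hV⟩ := mem_nhds_prod_iff.1 hpre
  obtain ⟨V, hVsub, hVo, h1V⟩ : ∃ V : Set G, V ⊆ V₁ ∩ V₂ ∧ IsOpen V ∧ (1 : G) ∈ V :=
    mem_nhds_iff.1 (inter_mem hV₁ hV₂)
  have hVW : ∀ v ∈ V, ∀ v' ∈ V, v'⁻¹ * v ∈ W := fun v hv v' hv' =>
    hV (mk_mem_prod (hVsub hv').1 (hVsub hv).2)
  -- the neighbourhood of `p = (x₀ T, t₀)`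
  obtain ⟨x₀, hx₀⟩ := QuotientGroup.mk_surjective p.1
  refine ⟨(QuotientGroup.mk '' ((fun v => x₀ * v) '' V)) ×ˢ univ, ?_, ?_, ?_⟩
  · exact (QuotientGroup.isOpenMap_coe _ ((isOpenMap_mul_left x₀) _ hVo)).prod isOpen_univ
  · refine ⟨?_, mem_univ _⟩
    rw [← hx₀]
    exact ⟨x₀ * 1, ⟨1, h1V, rfl⟩, by rw [mul_one]⟩
  · rintro ⟨q, t⟩ ⟨⟨hq, -⟩, ht⟩ ⟨q', t'⟩ ⟨⟨hq', -⟩, ht'⟩ heq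
    simp only [mem_image, exists_exists_and_eq_and] at hq hq'
    obtain ⟨v, hv, rfl⟩ := hq
    obtain ⟨v', hv', rfl⟩ := hq'
    simp only [mem_setOf_eq] at ht ht'
    rw [hΦ, hΦ] at heq
    -- `n = (x₀ v')⁻¹ (x₀ v)` conjugates `t` to `t'`
    set n : G := (x₀ * v')⁻¹ * (x₀ * v) with hn
    have hconj : n * (t : G) * n⁻¹ = (t' : G) := by
      have h2 := congrArg (fun y => (x₀ * v')⁻¹ * y * (x₀ * v')) heq
      rw [hn]
      calc (x₀ * v')⁻¹ * (x₀ * v) * ↑t * ((x₀ * v')⁻¹ * (x₀ * v))⁻¹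
          = (x₀ * v')⁻¹ * (x₀ * v * ↑t * (x₀ * v)⁻¹) * (x₀ * v') := by group
        _ = (x₀ * v')⁻¹ * (x₀ * v' * ↑t' * (x₀ * v')⁻¹) * (x₀ * v') := by rw [h2]
        _ = ↑t' := by group
    have hnN : n ∈ N := mem_normalizer_of_conj_eq T (hRT t ht) (hRT t' ht') hconj
    have hnW : n ∈ W := by
      have : n = v'⁻¹ * v := by rw [hn]; group
      rw [this]; exact hVW v hv v' hv'
    have hnT : n ∈ T := hWN n hnN hnW
    have hqq : (QuotientGroup.mk (x₀ * v) : G ⧸ T) = QuotientGroup.mk (x₀ * v') := by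
      rw [eq_comm, QuotientGroup.eq]
      exact hnT
    have htt : t = t' := by
      apply Subtype.ext
      rw [← hconj]
      have hc : n * (t : G) = (t : G) * n := hTc n hnT t t.2
      rw [hc, mul_inv_cancel_right]
    rw [hqq, htt]

omit [TopologicalSpace G] [IsTopologicalGroup G] in
include hTc hΦ hRT hRc hW in
/-- **Every fibre of `Φ` over `G^T` has exactly `|N_G(T) ∕ T|` points in `D`**: the fibre through `(x₀T, t₀)` is
`{(x₀ n⁻¹ T, n t₀ n⁻¹) : n ∈ N_G(T)} ≃ N_G(T) ∕ T`. [cite: HarishChandra1970, Lemma 42] -/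
theorem count_fibre_conjFamily_eq [MeasurableSpace ((G ⧸ T) × T)]
    [MeasurableSingletonClass ((G ⧸ T) × T)] {y : G}
    (hy : y ∈ Φ '' {p : (G ⧸ T) × T | ((p.2 : T) : G) ∈ R}) :
    Measure.count (Φ ⁻¹' {y} ∩ {p : (G ⧸ T) × T | ((p.2 : T) : G) ∈ R}) =
      ((T.subgroupOf (Subgroup.normalizer (T : Set G))).index : ℝ≥0∞) := by
  classical
  set N : Subgroup G := Subgroup.normalizer (T : Set G) with hN
  haveI : (T.subgroupOf N).FiniteIndex := ⟨hW⟩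
  obtain ⟨⟨q₀, t₀⟩, ht₀, rfl⟩ := hy
  obtain ⟨x₀, rfl⟩ := QuotientGroup.mk_surjective q₀
  simp only [mem_setOf_eq] at ht₀
  -- the parametrisation of the fibre by the normaliser
  have hmemT : ∀ n : N, (n : G) * (t₀ : G) * (n : G)⁻¹ ∈ T := fun n =>
    (Subgroup.mem_normalizer_iff.1 n.2 (t₀ : G)).1 t₀.2
  set Ψ : N → (G ⧸ T) × T := fun n =>
    (QuotientGroup.mk (x₀ * (n : G)⁻¹), ⟨(n : G) * (t₀ : G) * (n : G)⁻¹, hmemT n⟩) with hΨ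
  have hΨΦ : ∀ n : N, Φ (Ψ n) = Φ (QuotientGroup.mk x₀, t₀) := by
    intro n
    simp only [hΨ, hΦ]
    group
  have hΨR : ∀ n : N, (((Ψ n).2 : T) : G) ∈ R := fun n => hRc _ _ ht₀
  -- its range is the fibre
  have hrange : Set.range Ψ = Φ ⁻¹' {Φ (QuotientGroup.mk x₀, t₀)} ∩ {p | ((p.2 : T) : G) ∈ R} := by
    ext ⟨q, t⟩
    constructor
    · rintro ⟨n, hn⟩
      rw [← hn]
      exact ⟨hΨΦ n, hΨR n⟩
    · rintro ⟨hq, ht⟩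
      obtain ⟨x, rfl⟩ := QuotientGroup.mk_surjective q
      simp only [mem_preimage, mem_singleton_iff, hΦ] at hq
      simp only [mem_setOf_eq] at ht
      -- `n := x⁻¹ x₀` conjugates `t₀` to `t`
      have hconj : x⁻¹ * x₀ * (t₀ : G) * (x⁻¹ * x₀)⁻¹ = (t : G) := by
        calc x⁻¹ * x₀ * (t₀ : G) * (x⁻¹ * x₀)⁻¹ = x⁻¹ * (x₀ * ↑t₀ * x₀⁻¹) * x := by group
          _ = x⁻¹ * (x * ↑t * x⁻¹) * x := by rw [hq]
          _ = ↑t := by group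
      have hn : x⁻¹ * x₀ ∈ N := mem_normalizer_of_conj_eq T (hRT t₀ ht₀) (hRT t ht) hconj
      refine ⟨⟨x⁻¹ * x₀, hn⟩, ?_⟩
      simp only [hΨ]
      refine Prod.ext ?_ (Subtype.ext ?_)
      · simp only
        congr 1
        group
      · exact hconj
  -- its kernel is the coset relation of `T ∩ N` in `N`
  have hker : Setoid.ker Ψ = QuotientGroup.leftRel (T.subgroupOf N) := by
    ext n n'
    rw [Setoid.ker_def, QuotientGroup.leftRel_apply, Subgroup.mem_subgroupOf]
    simp only [hΨ, Prod.mk.injEq, Subgroup.coe_mul, Subgroup.coe_inv]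
    constructor
    · rintro ⟨hq, -⟩
      rw [QuotientGroup.eq] at hq
      -- `hq : (x₀ n⁻¹)⁻¹ (x₀ n'⁻¹) = n n'⁻¹ ∈ T`; conjugate by `n⁻¹ ∈ N`
      have h1 : (n : G) * (n' : G)⁻¹ ∈ T := by
        have : (x₀ * (n : G)⁻¹)⁻¹ * (x₀ * (n' : G)⁻¹) = (n : G) * (n' : G)⁻¹ := by group
        rwa [this] at hq
      have h2 : (n : G)⁻¹ * ((n : G) * (n' : G)⁻¹) * (n : G)⁻¹⁻¹ ∈ T :=
        (Subgroup.mem_normalizer_iff.1 (N.inv_mem n.2) _).1 h1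
      have h3 : ((n : G)⁻¹ * (n' : G))⁻¹ ∈ T := by
        have : (n : G)⁻¹ * ((n : G) * (n' : G)⁻¹) * (n : G)⁻¹⁻¹ = ((n : G)⁻¹ * (n' : G))⁻¹ := by group
        rwa [this] at h2
      exact (Subgroup.inv_mem_iff T).1 h3
    · intro h
      -- `n' = n s` with `s = n⁻¹ n' ∈ T`
      have hs : (n' : G) = (n : G) * ((n : G)⁻¹ * (n' : G)) := by group
      constructor
      · rw [QuotientGroup.eq]
        have : (x₀ * (n : G)⁻¹)⁻¹ * (x₀ * (n' : G)⁻¹) = (n : G) * ((n : G)⁻¹ * (n' : G))⁻¹ * (n : G)⁻¹ := by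
          group
        rw [this]
        exact (Subgroup.mem_normalizer_iff.1 n.2 _).1 (T.inv_mem h)
      · apply Subtype.ext
        simp only
        have hc : (n : G)⁻¹ * (n' : G) * (t₀ : G) = (t₀ : G) * ((n : G)⁻¹ * (n' : G)) := hTc _ h _ t₀.2
        calc (n : G) * ↑t₀ * (↑n)⁻¹ = (n : G) * (↑t₀ * ((↑n)⁻¹ * ↑n')) * ((↑n)⁻¹ * ↑n')⁻¹ * (↑n)⁻¹ := by group
          _ = (n : G) * ((↑n)⁻¹ * ↑n' * ↑t₀) * ((↑n)⁻¹ * ↑n')⁻¹ * (↑n)⁻¹ := by rw [hc]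
          _ = ↑n' * ↑t₀ * (↑n')⁻¹ := by group
  -- counting: `range Ψ ≃ N ⧸ (T ∩ N)` is finite of cardinality the index
  haveI hfinL : Finite (Quotient (QuotientGroup.leftRel (T.subgroupOf N))) := by
    change Finite (N ⧸ T.subgroupOf N)
    infer_instance
  haveI hfinQ : Finite (Quotient (Setoid.ker Ψ)) := by
    rw [hker]
    exact hfinL
  have hfinR : (Set.range Ψ).Finite := by
    haveI : Finite ↥(Set.range Ψ) := Finite.of_equiv _ (Setoid.quotientKerEquivRange Ψ)
    exact Set.toFinite _
  have hcard : (Set.range Ψ).encard = ((T.subgroupOf N).index : ℕ∞) := by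
    rw [Set.encard, ← ENat.card_congr (Setoid.quotientKerEquivRange Ψ), hker, ENat.card_eq_coe_natCard]
    rfl
  rw [← hrange, Measure.count_apply hfinR.measurableSet, hcard]
  simp

end OneTorus

end Literature.MeasureTheory.Group

end
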